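import Mathlib.Analysis.SpecialFunctions.SmoothTransition
import Mathlib.Analysis.SpecialFunctions.Trigonometric.Deriv
import Mathlib.Analysis.InnerProductSpace.PiL2
import Mathlib.Analysis.InnerProductSpace.Calculus
import Summits.SmoothPoincare4.SmoothPoincare4.Theses.DottedCircleRasmussen

/-!
# Helper `helper_friendsCarrier_Vk_partA_frameExt` (piece 1 of the registered stub
`helper_friendsCarrier_Vk_partA`, line `mk_friends`, skeleton v8) for crux `DcrGap`
(item stmt-SmoothPoincare4-16128, route route-SmoothPoincare4-DottedCircleRasmussen)

**Extending a loop of invertible `2 × 2` matrices with lifted first column over the disc.**  Part A of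
V_k (the framing theorem) ends with an extension problem: a transversal framing of the model slice disc
`f₁` over the closed disc is sought with PRESCRIBED values on the boundary circle; in a trivialisation of
the normal bundle the prescription is a loop `u ↦ M(u) = (a b; c d)(u)` of invertible matrices, and the
framing extends iff the loop is null-homotopic in `GL₂(ℝ)`, i.e. iff its first column `(a, c)` — a loop in
`ℝ² ∖ 0` — has a continuous polar angle.  This file proves the constructive half used by Part A: if the
first column is `r (cos θ, sin θ)` with `r > 0` and `θ` of class `C^∞` off the origin (the entries being
`C^∞` off the origin, e.g. radial extensions of smooth functions on the circle) and `det M` has a constant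
sign `ε`, then there are GLOBALLY `C^∞` functions `A, B, C, D` on `ℝ²`, equal to `a, b, c, d` on the unit
circle, with `A D - B C ≠ 0` EVERYWHERE.  Formula (Gram–Schmidt deformation of `GL₂⁺` onto `SO(2)`, Hatcher
§3.D, run along the radius): with a plateau `φ(x) = ψ(|x|²)` (`0` near the origin, `1` near the circle),
`M̃ = R(φ θ) · ((1 - φ) diag(1, ε) + φ R(-θ) M)`, where `R(-θ) M = (r q; 0 s)` is upper triangular with
`r > 0`, `ε s > 0`, so the blend stays invertible (`det M̃ = P S`, `P = (1 - φ) + φ r > 0`,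
`ε S = (1 - φ) + φ ε s > 0`), and `M̃` is constant near the origin.

* `FriendsCarrierVk.contDiff_plateau_mul` — `φ g` is globally `C^∞` for `g` smooth off the origin;
* `helper_friendsCarrier_Vk_partA_frameExt` — the registered statement.

No definitions (the plateau is the explicit expression `Real.smoothTransition (3‖x‖² - 1)`), no named facts,
no `sorry`.

## References

* A. Hatcher, *Algebraic Topology*, CUP (2002), §3.D (Gram–Schmidt: `SO(n)` is a deformation retract of
  `GL⁺ₙ(ℝ)`). [HatcherAT2002]
* M. W. Hirsch, *Differential Topology*, GTM 33 (1976), Ch. 4 §2 Cor. 2.5 (framings over a disc).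
  [Hirsch1976]
-/

-- the prescribed namespace `Summit.<P>.<Sub>.…` duplicates `SmoothPoincare4` (P = Sub)
set_option linter.dupNamespace false
set_option linter.style.longLine false

noncomputable section

open scoped ContDiff Topology
open Set Function Metric Filter

namespace Summit.SmoothPoincare4.SmoothPoincare4.Theorems.DcrGap.MkFriends

namespace FriendsCarrierVk

/-! ## The radial plateau `φ(x) = ψ(3|x|² - 1)` -/

/-- The plateau `φ(x) = smoothTransition (3‖x‖² - 1)` is `C^∞`. [folklore] -/
theorem contDiff_plateau : ContDiff ℝ ∞ fun x : EuclideanSpace ℝ (Fin 2) => Real.smoothTransition (3 * ‖x‖ ^ 2 - 1) := by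
  have h1 : ContDiff ℝ ∞ fun x : EuclideanSpace ℝ (Fin 2) => 3 * ‖x‖ ^ 2 - 1 :=
    (contDiff_const.mul (contDiff_norm_sq ℝ)).sub contDiff_const
  exact Real.smoothTransition.contDiff.comp h1

/-- The plateau vanishes on the ball of radius `1/2`. [folklore] -/
theorem plateau_eq_zero {x : EuclideanSpace ℝ (Fin 2)} (hx : ‖x‖ < 1 / 2) : Real.smoothTransition (3 * ‖x‖ ^ 2 - 1) = 0 := by
  apply Real.smoothTransition.zero_of_nonpos
  nlinarith [norm_nonneg x]

/-- The plateau is `1` on the unit circle. [folklore] -/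
theorem plateau_eq_one {x : EuclideanSpace ℝ (Fin 2)} (hx : ‖x‖ = 1) : Real.smoothTransition (3 * ‖x‖ ^ 2 - 1) = 1 := by
  rw [hx]
  exact Real.smoothTransition.one_of_one_le (by norm_num)

/-- **`φ g` is globally `C^∞` for `g` smooth off the origin** (it vanishes near the origin). [folklore] -/
theorem contDiff_plateau_mul {g : EuclideanSpace ℝ (Fin 2) → ℝ} (hg : ∀ x, x ≠ 0 → ContDiffAt ℝ ∞ g x) :
    ContDiff ℝ ∞ fun x => Real.smoothTransition (3 * ‖x‖ ^ 2 - 1) * g x := by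
  rw [contDiff_iff_contDiffAt]
  intro x
  by_cases hx : x = 0
  · subst hx
    have hev : (fun x : EuclideanSpace ℝ (Fin 2) => Real.smoothTransition (3 * ‖x‖ ^ 2 - 1) * g x) =ᶠ[𝓝 0] fun _ => 0 := by
      filter_upwards [ball_mem_nhds (0 : EuclideanSpace ℝ (Fin 2)) (by norm_num : (0 : ℝ) < 1 / 2)] with y hy
      rw [plateau_eq_zero (mem_ball_zero_iff.1 hy), zero_mul]
    exact (contDiffAt_const (c := (0 : ℝ))).congr_of_eventuallyEq hev
  · exact contDiff_plateau.contDiffAt.mul (hg x hx)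

/-! ## The extension -/

/-- **Extension of a boundary loop of invertible matrices with lifted first column.** [cite: HatcherAT2002, §3.D] -/
theorem exists_frameExt (a b c d r θ : EuclideanSpace ℝ (Fin 2) → ℝ) (ε : ℝ) (hε : ε = 1 ∨ ε = -1)
    (hb : ∀ x, x ≠ 0 → ContDiffAt ℝ ∞ b x) (hd : ∀ x, x ≠ 0 → ContDiffAt ℝ ∞ d x)
    (hr : ∀ x, x ≠ 0 → ContDiffAt ℝ ∞ r x) (hθ : ∀ x, x ≠ 0 → ContDiffAt ℝ ∞ θ x)
    (hrpos : ∀ x, x ≠ 0 → 0 < r x) (hac : ∀ x, x ≠ 0 → a x = r x * Real.cos (θ x))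
    (hcc : ∀ x, x ≠ 0 → c x = r x * Real.sin (θ x))
    (hdet : ∀ x, x ≠ 0 → 0 < ε * (a x * d x - b x * c x)) :
    ∃ A B C D : EuclideanSpace ℝ (Fin 2) → ℝ, ContDiff ℝ ∞ A ∧ ContDiff ℝ ∞ B ∧ ContDiff ℝ ∞ C ∧ ContDiff ℝ ∞ D ∧
      (∀ x, A x * D x - B x * C x ≠ 0) ∧ ∀ x, ‖x‖ = 1 → A x = a x ∧ B x = b x ∧ C x = c x ∧ D x = d x := by
  set plateau : EuclideanSpace ℝ (Fin 2) → ℝ := fun x => Real.smoothTransition (3 * ‖x‖ ^ 2 - 1) with hpl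
  have plateau_mem : ∀ x, 0 ≤ plateau x ∧ plateau x ≤ 1 := fun x =>
    ⟨Real.smoothTransition.nonneg _, Real.smoothTransition.le_one _⟩
  have hε2 : ε * ε = 1 := by rcases hε with h | h <;> subst h <;> norm_num
  have hεne : ε ≠ 0 := by rcases hε with h | h <;> subst h <;> norm_num
  -- the upper triangular factor `R(-θ) M = (r q; 0 s)`
  set q : EuclideanSpace ℝ (Fin 2) → ℝ := fun x => Real.cos (θ x) * b x + Real.sin (θ x) * d x with hq
  set s : EuclideanSpace ℝ (Fin 2) → ℝ := fun x => -Real.sin (θ x) * b x + Real.cos (θ x) * d x with hs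
  have hqs : ∀ x, x ≠ 0 → ContDiffAt ℝ ∞ q x ∧ ContDiffAt ℝ ∞ s x := fun x hx =>
    ⟨((hθ x hx).cos.mul (hb x hx)).add ((hθ x hx).sin.mul (hd x hx)),
      ((hθ x hx).sin.neg.mul (hb x hx)).add ((hθ x hx).cos.mul (hd x hx))⟩
  -- `det M = r s`
  have hdet' : ∀ x, x ≠ 0 → a x * d x - b x * c x = r x * s x := fun x hx => by
    rw [hac x hx, hcc x hx, hs]; ring
  have hspos : ∀ x, x ≠ 0 → 0 < ε * s x := fun x hx => by
    have h := hdet x hx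
    rw [hdet' x hx, show ε * (r x * s x) = r x * (ε * s x) by ring] at h
    exact pos_of_mul_pos_right h (hrpos x hx).le
  -- the globally smooth ingredients
  set ang : EuclideanSpace ℝ (Fin 2) → ℝ := fun x => plateau x * θ x with hang
  set P : EuclideanSpace ℝ (Fin 2) → ℝ := fun x => (1 - plateau x) + plateau x * r x with hP
  set Q : EuclideanSpace ℝ (Fin 2) → ℝ := fun x => plateau x * q x with hQ
  set S : EuclideanSpace ℝ (Fin 2) → ℝ := fun x => (1 - plateau x) * ε + plateau x * s x with hS
  have hangs : ContDiff ℝ ∞ ang := contDiff_plateau_mul hθ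
  have hPs : ContDiff ℝ ∞ P := (contDiff_const.sub contDiff_plateau).add (contDiff_plateau_mul hr)
  have hQs : ContDiff ℝ ∞ Q := contDiff_plateau_mul fun x hx => (hqs x hx).1
  have hSs : ContDiff ℝ ∞ S := ((contDiff_const.sub contDiff_plateau).mul contDiff_const).add
    (contDiff_plateau_mul fun x hx => (hqs x hx).2)
  -- positivity of `P` and `ε S`
  have hPpos : ∀ x, 0 < P x := fun x => by
    obtain ⟨h0, h1⟩ := plateau_mem x
    by_cases hx : x = 0
    · subst hx
      have h00 : plateau 0 = 0 := plateau_eq_zero (by norm_num)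
      simp only [hP, h00]; norm_num
    · simp only [hP]
      have := hrpos x hx
      rcases h0.eq_or_lt with h | h
      · rw [← h]; norm_num
      · nlinarith
  have hSpos : ∀ x, 0 < ε * S x := fun x => by
    obtain ⟨h0, h1⟩ := plateau_mem x
    by_cases hx : x = 0
    · subst hx
      have h00 : plateau 0 = 0 := plateau_eq_zero (by norm_num)
      simp only [hS, h00]; nlinarith
    · simp only [hS]
      have := hspos x hx
      have : ε * ((1 - plateau x) * ε + plateau x * s x) = (1 - plateau x) * (ε * ε) + plateau x * (ε * s x) := by ring
      rw [this, hε2]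
      rcases h0.eq_or_lt with h | h
      · rw [← h]; norm_num
      · nlinarith
  -- the rotated blend
  refine ⟨fun x => Real.cos (ang x) * P x, fun x => Real.cos (ang x) * Q x - Real.sin (ang x) * S x,
    fun x => Real.sin (ang x) * P x, fun x => Real.sin (ang x) * Q x + Real.cos (ang x) * S x,
    hangs.cos.mul hPs, (hangs.cos.mul hQs).sub (hangs.sin.mul hSs), hangs.sin.mul hPs,
    (hangs.sin.mul hQs).add (hangs.cos.mul hSs), fun x => ?_, fun x hx => ?_⟩
  · -- `det = P S`
    have h : Real.cos (ang x) * P x * (Real.sin (ang x) * Q x + Real.cos (ang x) * S x) -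
        (Real.cos (ang x) * Q x - Real.sin (ang x) * S x) * (Real.sin (ang x) * P x) =
        P x * S x * (Real.sin (ang x) ^ 2 + Real.cos (ang x) ^ 2) := by ring
    rw [h, Real.sin_sq_add_cos_sq, mul_one]
    have h1 := hPpos x
    have h2 := hSpos x
    intro h0
    have : ε * (P x * S x) = 0 := by rw [h0, mul_zero]
    have h3 : 0 < P x * (ε * S x) := mul_pos h1 h2
    nlinarith
  · -- boundary values
    have hx0 : x ≠ 0 := by rintro rfl; simp at hx
    have h1 : plateau x = 1 := by rw [hpl]; exact plateau_eq_one hx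
    have hang1 : ang x = θ x := by simp only [hang, h1, one_mul]
    have hP1 : P x = r x := by simp only [hP, h1]; ring
    have hQ1 : Q x = q x := by simp only [hQ, h1, one_mul]
    have hS1 : S x = s x := by simp only [hS, h1]; ring
    simp only [hang1, hP1, hQ1, hS1, hq, hs]
    refine ⟨by rw [hac x hx0]; ring, ?_, by rw [hcc x hx0]; ring, ?_⟩
    · have := Real.sin_sq_add_cos_sq (θ x)
      linear_combination b x * this
    · have := Real.sin_sq_add_cos_sq (θ x)
      linear_combination d x * this

end FriendsCarrierVk

open FriendsCarrierVk in
/-- **Helper `helper_friendsCarrier_Vk_partA_frameExt`** (piece of `helper_friendsCarrier_Vk_partA`: the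
extension over the plane of a loop of invertible `2 × 2` matrices whose first column has a smooth polar
angle).  Let `a, b, c, d, r, θ : ℝ² → ℝ` with `b, d, r, θ` of class `C^∞` off the origin, `r > 0`,
`a = r cos θ`, `c = r sin θ` off the origin, and `ε (a d - b c) > 0` off the origin for a sign `ε = ±1`.
Then there are `C^∞` functions `A, B, C, D` on all of `ℝ²` with `A D - B C ≠ 0` everywhere and
`(A, B, C, D) = (a, b, c, d)` on the unit circle. [cite: HatcherAT2002, §3.D] -/
theorem helper_friendsCarrier_Vk_partA_frameExt : ∀ (a b c d r θ : EuclideanSpace ℝ (Fin 2) → ℝ) (ε : ℝ), (ε = 1 ∨ ε = -1) → (∀ x, x ≠ 0 → ContDiffAt ℝ ((⊤ : ℕ∞) : WithTop ℕ∞) b x) → (∀ x, x ≠ 0 → ContDiffAt ℝ ((⊤ : ℕ∞) : WithTop ℕ∞) d x) → (∀ x, x ≠ 0 → ContDiffAt ℝ ((⊤ : ℕ∞) : WithTop ℕ∞) r x) → (∀ x, x ≠ 0 → ContDiffAt ℝ ((⊤ : ℕ∞) : WithTop ℕ∞) θ x) → (∀ x, x ≠ 0 → 0 < r x) → (∀ x,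 x ≠ 0 → a x = r x * Real.cos (θ x)) → (∀ x, x ≠ 0 → c x = r x * Real.sin (θ x)) → (∀ x, x ≠ 0 → 0 < ε * (a x * d x - b x * c x)) → ∃ A B C D : EuclideanSpace ℝ (Fin 2) → ℝ, ContDiff ℝ ((⊤ : ℕ∞) : WithTop ℕ∞) A ∧ ContDiff ℝ ((⊤ : ℕ∞) : WithTop ℕ∞) B ∧ ContDiff ℝ ((⊤ : ℕ∞) : WithTop ℕ∞) C ∧ ContDiff ℝ ((⊤ : ℕ∞) : WithTop ℕ∞) D ∧ (∀ x, A x * D x - B x * C x ≠ 0) ∧ ∀ x, ‖x‖ = 1 → A x = a x ∧ B x = b x ∧ C x = c x ∧ D x = d x :=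
  exists_frameExt

end Summit.SmoothPoincare4.SmoothPoincare4.Theorems.DcrGap.MkFriends

end
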